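import Summits.BirchSwinnertonDyer.BirchSwinnertonDyer.Theorems.BiquadraticEisensteinDescentManinDatumSupercuspidalCMInertResolventCertificate
import Summits.BirchSwinnertonDyer.BirchSwinnertonDyer.Theorems.BiquadraticEisensteinDescentManinDatumSupercuspidalCMInertResolventBoundReduction
import HarnessLib

set_option linter.dupNamespace false -- `Summit.BirchSwinnertonDyer.BirchSwinnertonDyer.Theorems.…` (summit = sub, D-0017)
set_option autoImplicit false

/-!
# Crux `ManinDatumSupercuspidalCMInert` (stmt-BirchSwinnertonDyer-20111, BED r605) — ★ the registered stub `stub_S7` (skeleton `9438078f…`),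
# UNCONDITIONALLY: the `j = 1728` quartic cells `III / III*` at `p = 7` of the supercuspidal Manin residual
# (width seat `bsd-wall-cm-bed-w3` g10; one theorem; `--supports 20111`)

Route `BiquadraticEisensteinDescent` (cell `pub/bsd-wall`).  Composition of two tree theorems:
* bed-w2 g10's `…ResolventBoundReduction.stub_S7_of_smallEvenResolventBound : RES₇fin → stub_S7` (range reduction of the resolvent bound;
  itself standing on `stub_S7_of_resolventBound` ← `core_seven_of_resolventBound` ← bed-w3 g9's `H7_of_core` / `torsionSum_seven_eq` ←
  bed-w2 g10's `H7_of_torsionIntegral` / `stub_S7_of_modelOddLValues` ← bed-w4 g10's tame-twist lever and `7`-division Eisenstein input ←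
  bed-w3 g9's theta dictionary `QuarticTwist.lSeries_twist_eq_thetaLFunction_inert`), and
* this seat's `…ResolventCertificate.smallEvenResolventBound_seven : RES₇fin` (the explicit complex-multiplication certificate:
  `GaussianLatticeCMFive`, `…ResolventCertificateLabels/PowersA/PowersB/PowersC/Sums/SumsB/Regroup`).

So `stub_S7` — «for a CM curve `W/ℚ` of analytic rank `1` with `j = 1728`, additive at the inert prime `7` (Kodaira `III` or `III*`), and a
lattice-optimal `X₀(N)`-datum `D`: `7 ∤ c(D)`» — is a THEOREM of the tree with no named-fact hypothesis.  HONEST FRAMING: this closes ONE of the two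
registered stubs of crux 20111; `stub_S5` (the `j = 0` sextic cells at `5`) remains OPEN, hence so do the crux `ManinDatumSupercuspidalCMInert`, its
parent `ManinDatumFiveSevenCMInert`, Manin's conjecture in general, and BSD.  No definition, no named fact, no `sorry`; axioms standard.
-/

noncomputable section

open scoped Classical ComplexConjugate
open Complex PeriodPair WeierstrassCurve IsDedekindDomain NumberField
open Literature.NumberTheory.EllipticCurves Literature.NumberTheory.EllipticCurves.GaussianLattice
open Literature.NumberTheory.LFunctions Literature.NumberTheory.LFunctions.GaussianTheta
open Literature.NumberTheory.QuadraticFields.GaussianQuarticSymbol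
open Literature.NumberTheory.EllipticCurves.ModularForms
open Literature.NumberTheory.EllipticCurves.Rank1Residual
open Literature.NumberTheory.DiophantineGeometry

namespace Summit.BirchSwinnertonDyer.BirchSwinnertonDyer.Theorems.BiquadraticEisensteinDescentManinDatumSupercuspidalCMInertStubS7

open Summit.BirchSwinnertonDyer.BirchSwinnertonDyer.Theorems.BiquadraticEisensteinDescentManinDatumSupercuspidalCMInertResolventBoundReduction
  (stub_S7_of_smallEvenResolventBound)
open Summit.BirchSwinnertonDyer.BirchSwinnertonDyer.Theorems.BiquadraticEisensteinDescentManinDatumSupercuspidalCMInertResolventCertificate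
  (smallEvenResolventBound_seven)

/-- ★★ **`stub_S7` of crux `ManinDatumSupercuspidalCMInert` (stmt-BirchSwinnertonDyer-20111), registered signature VERBATIM, unconditionally**:
for a CM elliptic curve `W/ℚ` (globally minimal model) of analytic rank `1` with `j(W) = 1728`, `7` inert in the CM field and bad for `W`
(Kodaira type `III` or `III*` at the place `v ∣ 7`), and a lattice-optimal modular parametrisation datum `D` of level `N_W`: `7 ∤ c(D)` —
the `p = 7` supercuspidal cells of Manin's conjecture for CM curves.  Proof: bed-w2 g10's reduction to the fifteen small even resolvent
bounds RES₇fin, discharged by the explicit `7`-division certificate `smallEvenResolventBound_seven`.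
[cite: Serre1979, Ch. IV §2 Prop. 7] [cite: Rubin1999, Prop. 7.15] -/
theorem stub_S7 :
    ∀ (W : WeierstrassCurve ℚ) [W.IsElliptic] [W.IsGloballyMinimal] [NeZero (W.conductorNorm ℤ)] (p : ℕ) [Fact p.Prime]
      (D : ModularParametrizationData W (W.conductorNorm ℤ)) (v : IsDedekindDomain.HeightOneSpectrum ℤ),
      Rat.HeightOneSpectrum.natGenerator v = p → W.HasCM → W.analyticRank = 1 → p = 7 → W.j = 1728 → CMInert W p → ¬ Good W p →
      (∀ z ∈ D.L.lattice, ∃ w ∈ periodLattice D.f, z = D.c * w) → (W.kodairaSymbolAt v = .III ∨ W.kodairaSymbolAt v = .IIIstar) →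
      ¬ (p : ℤ) ∣ D.c :=
  stub_S7_of_smallEvenResolventBound smallEvenResolventBound_seven

end Summit.BirchSwinnertonDyer.BirchSwinnertonDyer.Theorems.BiquadraticEisensteinDescentManinDatumSupercuspidalCMInertStubS7

end
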